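import Summits.HodgeConjecture.HodgeConjecture.Theorems.GenericDivisibilityGenericDivisibilityBoundedFunctionField
import Summits.HodgeConjecture.HodgeConjecture.Theorems.GenericDivisibilityGenericDivisibilityBoundedHeartStructure
import HarnessLib

/-!
# Route GenericDivisibility — crux C2 `GenericDivisibilityBounded` (stmt-HodgeConjecture-18467):
# the crux and `GT` at the generic point `H^{2p}(ℂ(X); ℤ)`

Lead c4 (cycle 6). Sorry-free, definition-free. Sequel of `…FunctionField` (p160865: the crux
hypothesis at `m` ⟺ `m ∣ z_η` in `H^k(ℂ(X);ℤ) = Motives.functionFieldCohomology ℤ X k`, Bloch–Ogus (3.9))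
and of `…SupportedTop` / `…HeartStructure` (`GT = N¹ ∩ H_ℤ`, integral coniveau `⊆ GT`). With
`ρ := Motives.toFunctionField ℤ X k : H^k(X(ℂ);ℤ) → H^k(ℂ(X);ℤ)` the restriction to the generic point:

* `genericDivisibilityBounded_GT_iff_exists_toFunctionField_nsmul_eq_zero` — **`GT = ρ⁻¹(torsion)`**:
  `z` is generically torsion iff `ρ(N • z) = 0` for some `N ≥ 1` (`ker ρ = N¹_ℤ`, Bloch–Ogus (3.8),
  PROVED in the tree as `Motives.ker_toFunctionField_eq_coniveauFiltration_one`);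
* `genericDivisibilityBounded_at_iff_functionField` — **C2 at `X` in degree `k`** ⟺ every integral
  class whose generic restriction is divisible by every `m ≥ 1` has complexification in `N¹`;
* `genericDivisibilityBounded_at_iff_functionField'`, registered sub-goal `stub_cruxAtIffFunctionField`
  — the same with the conclusion also at the generic point: **C2 at `X` ⟺
  `ρ⁻¹(⋂ₘ m · H^k(ℂ(X);ℤ)) ⊆ ρ⁻¹(H^k(ℂ(X);ℤ)_tors)`** ("an integral class infinitely divisible at the
  generic point is torsion at the generic point"); granted Colliot-Thélène–Voisin's torsion-freeness of
  `H^k(ℂ(X);ℤ)` (the route's `TorsionDiesGenerically`) this is `im ρ ∩ div H^k(ℂ(X);ℤ) = 0`, the form of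
  Disproof.lean §1 / HEART-c2 §B, now on the tree's carriers.

References: [BlochOgus1974ENS] (3.8)–(3.9); [ColliotTheleneVoisin2012] §2.1, Thm. 2.8 (ii), §3.1.
-/

set_option linter.dupNamespace false

noncomputable section

namespace Summit.HodgeConjecture.HodgeConjecture.Theorems

open CategoryTheory AlgebraicGeometry Opposite TopologicalSpace
open Literature.AlgebraicGeometry.Motives Literature.AlgebraicGeometry.HodgeTheory
  Literature.AlgebraicTopology.SingularHomology

/-- Restriction `H^k(X(ℂ);ℤ) → H^k((X∖Z)(ℂ);ℤ)`, the very term of the route decls (notation only). -/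
local notation3 (prettyPrint := false) "Res[" X ", " Z ", " k "]" =>
  singularCohomology.map ℤ ℤ
    (⟨Subtype.val, continuous_subtype_val⟩ : C(complexPointsCompl X Z, ComplexPoints X)) k

/-! ### `GT` at the generic point -/

/-- **`GT = ρ⁻¹(torsion)`**: on an irreducible `X`, an integral class `z` is generically torsion
(`∃ Z` closed `≠ univ`, `∃ N ≥ 1`, `N • z|_{(X∖Z)(ℂ)} = 0`) iff `ρ(N • z) = 0` in `H^k(ℂ(X);ℤ)` for some
`N ≥ 1`, `ρ` the restriction to the generic point: `ker ρ = N¹_ℤ H^k` (Bloch–Ogus (3.8), proved in the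
tree) and `N • z ∈ N¹_ℤ` is exactly "`N • z` dies off one proper closed subset".
[cite: BlochOgus1974ENS, (3.8)] -/
theorem genericDivisibilityBounded_GT_iff_exists_toFunctionField_nsmul_eq_zero {X : SchemeOver ℂ}
    [IrreducibleSpace X.left] {k : ℕ} (z : singularCohomology ℤ ℤ (ComplexPoints X) k) :
    (∃ Z : Set X.left, IsClosed Z ∧ Z ≠ Set.univ ∧ ∃ N : ℕ, 1 ≤ N ∧ N • Res[X, Z, k] z = 0) ↔
      ∃ N : ℕ, 1 ≤ N ∧ toFunctionField ℤ X k (N • z) = 0 := by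
  constructor
  · rintro ⟨Z, hZ, hZne, N, hN, h0⟩
    refine ⟨N, hN, (mem_coniveauFiltration_one_iff_toFunctionField_eq_zero ℤ X k (N • z)).1 ?_⟩
    refine mem_coniveauFiltration_of_restrictToCompl_eq_zero ℤ k hZ
      ((forall_one_le_coheight_iff_ne_univ hZ).2 hZne) ?_
    change Res[X, Z, k] (N • z) = 0
    rw [map_nsmul, h0]
  · rintro ⟨N, hN, h0⟩
    have hmem := (mem_coniveauFiltration_one_iff_toFunctionField_eq_zero ℤ X k (N • z)).2 h0
    exact genericDivisibilityBounded_genericallyTorsion_of_nsmul hN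
      (genericDivisibilityBounded_mem_GT_of_mem_coniveauFiltration_int hmem)

/-! ### The crux at the generic point -/

/-- **C2 at `X` in degree `k`, hypothesis at the generic point**: on an irreducible `X`, the crux at
`X` ("`z` divisible by every `m ≥ 1` on non-empty Zariski opens ⇒ `z ⊗ ℂ ∈ N¹`") is equivalent to:
every integral class whose restriction `z_η ∈ H^k(ℂ(X);ℤ)` to the generic point is divisible by every
`m ≥ 1` has complexification in `N¹` (p160865 at each `m`). [cite: BlochOgus1974ENS, (3.9)]
[cite: ColliotTheleneVoisin2012, §2.1 and Thm. 2.8 (ii)] -/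
theorem genericDivisibilityBounded_at_iff_functionField {X : SchemeOver ℂ} [IrreducibleSpace X.left]
    (k : ℕ) :
    (∀ z : singularCohomology ℤ ℤ (ComplexPoints X) k,
      (∀ m : ℕ, 1 ≤ m → ∃ Z : Set X.left, IsClosed Z ∧ Z ≠ Set.univ ∧
        ∃ y : singularCohomology ℤ ℤ (complexPointsCompl X Z) k, m • y = Res[X, Z, k] z) →
      singularCohomology.ringChange (Int.castRingHom ℂ) (ComplexPoints X) k z ∈ supportedClasses X k 1) ↔
    (∀ z : singularCohomology ℤ ℤ (ComplexPoints X) k,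
      (∀ m : ℕ, 1 ≤ m → ∃ y : functionFieldCohomology ℤ X k, m • y = toFunctionField ℤ X k z) →
      singularCohomology.ringChange (Int.castRingHom ℂ) (ComplexPoints X) k z ∈ supportedClasses X k 1) := by
  refine forall_congr' fun z ↦ imp_congr_left (forall_congr' fun m ↦ imp_congr_right fun _ ↦ ?_)
  exact stub_genericallyDivisibleIffFunctionField k z m

/-- **C2 at `X` entirely at the generic point**: on a smooth projective `X`, in degree `k ≥ 1`, the crux
at `X` is equivalent to "an integral class infinitely divisible at the generic point is TORSION at the
generic point": `(∀ m ≥ 1, m ∣ ρ z) ⇒ ∃ N ≥ 1, ρ(N • z) = 0`, i.e.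
`ρ⁻¹(⋂ₘ m · H^k(ℂ(X);ℤ)) ⊆ ρ⁻¹(H^k(ℂ(X);ℤ)_tors)` — the conclusion `z ⊗ ℂ ∈ N¹` being `z ∈ GT`
(`GT = N¹ ∩ H_ℤ`, p160596) and `GT = ρ⁻¹(torsion)`. Granted the torsion-freeness of `H^k(ℂ(X);ℤ)`
(Colliot-Thélène–Voisin 2012 Thm. 3.1) this reads `im ρ ∩ div H^k(ℂ(X);ℤ) = 0`.
[cite: BlochOgus1974ENS, (3.8)–(3.9)] [cite: ColliotTheleneVoisin2012, §2.1, Thm. 2.8 (ii) and §3.1] -/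
theorem genericDivisibilityBounded_at_iff_functionField' {n₀ : ℕ} {X : SchemeOver ℂ}
    [IrreducibleSpace X.left] (hX : IsSmoothProjective n₀ X) {k : ℕ} (hk : 1 ≤ k) :
    (∀ z : singularCohomology ℤ ℤ (ComplexPoints X) k,
      (∀ m : ℕ, 1 ≤ m → ∃ Z : Set X.left, IsClosed Z ∧ Z ≠ Set.univ ∧
        ∃ y : singularCohomology ℤ ℤ (complexPointsCompl X Z) k, m • y = Res[X, Z, k] z) →
      singularCohomology.ringChange (Int.castRingHom ℂ) (ComplexPoints X) k z ∈ supportedClasses X k 1) ↔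
    (∀ z : singularCohomology ℤ ℤ (ComplexPoints X) k,
      (∀ m : ℕ, 1 ≤ m → ∃ y : functionFieldCohomology ℤ X k, m • y = toFunctionField ℤ X k z) →
      ∃ N : ℕ, 1 ≤ N ∧ toFunctionField ℤ X k (N • z) = 0) := by
  rw [genericDivisibilityBounded_at_iff_functionField]
  refine forall_congr' fun z ↦ imp_congr_right fun _ ↦ ?_
  rw [← genericDivisibilityBounded_genericallyTorsion_iff_ringChange_mem_supportedClasses hX hk z,
    genericDivisibilityBounded_GT_iff_exists_toFunctionField_nsmul_eq_zero]

/-- **Registered sub-goal `stub_cruxAtIffFunctionField` of stmt-HodgeConjecture-18467 (lead c4): the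
crux at `X`, entirely at the generic point**, verbatim. [cite: BlochOgus1974ENS, (3.8)–(3.9)]
[cite: ColliotTheleneVoisin2012, §2.1 and Thm. 2.8 (ii)] -/
theorem stub_cruxAtIffFunctionField : ∀ ⦃n₀ : ℕ⦄ ⦃X : SchemeOver ℂ⦄ [IrreducibleSpace X.left], IsSmoothProjective n₀ X → ∀ k : ℕ, 1 ≤ k → ((∀ z : singularCohomology ℤ ℤ (ComplexPoints X) k, (∀ m : ℕ, 1 ≤ m → ∃ Z : Set X.left, IsClosed Z ∧ Z ≠ Set.univ ∧ ∃ y : singularCohomology ℤ ℤ (complexPointsCompl X Z) k, m • y = singularCohomology.map ℤ ℤ (⟨Subtype.val, continuous_subtype_val⟩ : C(complexPointsCompl X Z, ComplexPoints X)) k z) → singularCohomology.ringChange (Int.castRingHom ℂ) (ComplexPoints X) k z ∈ supportedClasses X k 1) ↔ (∀ z : singularCohomology ℤ ℤ (ComplexPoints X) k, (∀ m : ℕ, 1 ≤ m → ∃ y : functionFieldCohomology ℤ X k, m • y = toFunctionField ℤ X k z) → ∃ N : ℕ, 1 ≤ N ∧ toFunctionField ℤ X k (N • z) = 0)) :=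
  fun _ _ _ hX _ hk ↦ genericDivisibilityBounded_at_iff_functionField' hX hk

end Summit.HodgeConjecture.HodgeConjecture.Theorems

end
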